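import Mathlib

/-!
# DoorA26 (stmt-ValiantsHypothesis-19979), END DOOR `EG15` — NEGATIVE lane:
# a Poincaré factor `(X + s)^N` of exponent `N ≤ 3` never lowers the Descartes count of the 15-nomial

Refuter (critic val-idea-crit-5 g6) certificate, 2026-08-29.  The END-door statement file
`Cruxes/DoorA26/Lines/wall_bubbling_EndDoor.lean` (rev 9) types the OPEN certificate family
`EG15Poincare N := ∀ S symmetric on a full-alternation chart, ∃ s > 0, signVariations (eg15Poly S * (X + C s)^N) ≤ 13`
with `eg15_of_poincare : EG15Poincare N → EG15` and `poincare_of_le : N ≤ N' → EG15Poincare N → EG15Poincare N'`.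

**Theorem** (`fourteen_le_signVariations_mul_X_add_C_pow`, def-free).  Let `P : ℝ[X]` have support inside
`V15 = {14,17,20,28,30,33,36,44,48,51,54,60,62,78,96}` and coefficients of alternating (non-zero) sign along `V15`
(= the two full-alternation charts of the line file, by its `eg15Poly_expand` / `eg15ChartLaw_holds`).  Then for
every `s > 0` and every `N ≤ 3`, `14 ≤ signVariations (P * (X + C s)^N)`.

Hence, once linked in the line file by `rw [eg15Poly_expand]`-free application to `P := eg15Poly S`
(`eg15Poly_support_subset`, chart signs), `¬ EG15Poincare N` for `N ≤ 3` at EVERY chart point — the family (i)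
starts at `N = 4` at the earliest.  STRUCTURAL REASON (the proof): for `N ≤ 3` every exponent `v ∈ V15` owns a
PURE position `m ∈ [v, v + N]` (no other `v' ∈ V15` in `[m − N, m]`, because consecutive gaps of `V15` are ≥ 2 and
sums of two consecutive gaps are ≥ 5), where the coefficient of `P * (X + s)^N` is `(N choose m−v) s^{N−(m−v)} · c_v`;
the fifteen pure positions increase with `v`, so the product keeps 15 alternating anchors, i.e. ≥ 14 variations
(`length_le_signVariations_succ_of_alternating`, an `eraseLead` induction on Mathlib's
`signVariations_eq_eraseLead_add_ite`).  At `N = 4` the exponent `v = 30` has no pure position (window `28,30,33`),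
so nothing structural is claimed there: whether some `EG15Poincare N`, `N ≥ 4`, holds is untouched and OPEN.

No definitions; no conclusion asserts a Theses declaration; `--supports` stmt-ValiantsHypothesis-19979
(pruning of an OPEN certificate family of the END door only — `EG15`, `DoorA26`, 18050 and VP ≠ VNP are not moved).
[folklore]
-/

namespace Summit.ValiantsHypothesis.ValiantsHypothesis.Theorems.DoorA26.Negative

-- single-conjunct layout: Sub = Summit, duplicated namespace component intended
set_option linter.dupNamespace false

open Polynomial

/-- Two non-zero signs that are not opposite are equal. -/
theorem signType_eq_of_ne_neg {x y : SignType} (hx : x ≠ 0) (hy : y ≠ 0) (h : ¬ x = -y) : x = y := by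
  revert hx hy h; cases x <;> cases y <;> decide

/-- **Alternating anchors bound the Descartes count from below.**  If `Q` has non-zero coefficients of pairwise
opposite signs at consecutive members of a strictly decreasing list `L` of exponents, then
`L.length ≤ signVariations Q + 1`. [folklore] -/
theorem length_le_signVariations_succ_of_alternating :
    ∀ (n : ℕ) (Q : ℝ[X]) (L : List ℕ), Q.support.card = n → L.Pairwise (· > ·) →
      (∀ t ∈ L, Q.coeff t ≠ 0) → L.IsChain (fun a b => Q.coeff a * Q.coeff b < 0) →
      L.length ≤ Q.signVariations + 1 := by
  intro n
  induction n using Nat.strong_induction_on with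
  | _ n ih =>
  intro Q L hcard hsort hnz hchain
  match L, hsort, hnz, hchain with
  | [], _, _, _ => simp
  | [a], _, _, _ => simp
  | a :: b :: L', hsort, hnz, hchain =>
    have ha0 : Q.coeff a ≠ 0 := hnz a (by simp)
    have hb0 : Q.coeff b ≠ 0 := hnz b (by simp)
    have hQ : Q ≠ 0 := fun h => ha0 (by rw [h, coeff_zero])
    have hpos : 0 < Q.support.card := Finset.card_pos.mpr (support_nonempty.mpr hQ)
    have hcardE : Q.eraseLead.support.card = n - 1 := by rw [card_support_eraseLead, hcard]
    have hltE : n - 1 < n := by omega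
    have had : a ≤ Q.natDegree := le_natDegree_of_ne_zero ha0
    have htail : ∀ t ∈ (b :: L'), t < a := fun t ht => (List.pairwise_cons.mp hsort).1 t ht
    have hsortT : (b :: L').Pairwise (· > ·) := (List.pairwise_cons.mp hsort).2
    have hmono := signVariations_eraseLead_le Q
    rcases Nat.eq_or_lt_of_le had with hEq | hlt
    · -- `a` is the degree: erasing the lead keeps the anchors `b :: L'`
      have hcoeT : ∀ t ∈ (b :: L'), Q.eraseLead.coeff t = Q.coeff t := fun t ht =>
        eraseLead_coeff_of_ne t (by rw [← hEq]; exact (htail t ht).ne)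
      have hEb : Q.eraseLead.coeff b ≠ 0 := by rw [hcoeT b (by simp)]; exact hb0
      have hE : Q.eraseLead ≠ 0 := fun h => hEb (by rw [h, coeff_zero])
      have hrec := signVariations_eq_eraseLead_add_ite hQ
      have hab : Q.coeff a * Q.coeff b < 0 := (List.isChain_cons_cons.mp hchain).1
      have hchainT : (b :: L').IsChain (fun x y => Q.eraseLead.coeff x * Q.eraseLead.coeff y < 0) := by
        refine List.IsChain.imp_of_mem_imp ?_ (List.isChain_cons_cons.mp hchain).2
        intro x y hx hy hxy
        rwa [hcoeT x hx, hcoeT y hy]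
      have hnzT : ∀ t ∈ (b :: L'), Q.eraseLead.coeff t ≠ 0 := fun t ht => by
        rw [hcoeT t ht]; exact hnz t (List.mem_cons_of_mem a ht)
      by_cases hite : SignType.sign Q.leadingCoeff = -SignType.sign Q.eraseLead.leadingCoeff
      · rw [if_pos hite] at hrec
        have h1 := ih (n - 1) hltE Q.eraseLead (b :: L') hcardE hsortT hnzT hchainT
        simp only [List.length_cons] at h1 ⊢
        omega
      · rw [if_neg hite] at hrec
        have hsQ : SignType.sign Q.leadingCoeff ≠ 0 := fun h =>
          (leadingCoeff_ne_zero.mpr hQ) (sign_eq_zero_iff.mp h)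
        have hsE : SignType.sign Q.eraseLead.leadingCoeff ≠ 0 := fun h =>
          (leadingCoeff_ne_zero.mpr hE) (sign_eq_zero_iff.mp h)
        have hsame : SignType.sign Q.leadingCoeff = SignType.sign Q.eraseLead.leadingCoeff :=
          signType_eq_of_ne_neg hsQ hsE hite
        have hQa : Q.coeff a = Q.leadingCoeff := by rw [leadingCoeff, ← hEq]
        -- the new top anchor: the degree `d'` of `eraseLead Q`
        have hbd' : b ≤ Q.eraseLead.natDegree := le_natDegree_of_ne_zero hEb
        have hEd' : Q.eraseLead.coeff Q.eraseLead.natDegree = Q.eraseLead.leadingCoeff := rfl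
        -- sign bookkeeping with real numbers: `lc Q` and `lc (eraseLead Q)` have the same sign, `Q.coeff a = lc Q`,
        -- and `Q.coeff a * Q.coeff b < 0`; hence `lc (eraseLead Q) * (eraseLead Q).coeff b < 0`.
        have hprod : Q.eraseLead.coeff Q.eraseLead.natDegree * Q.eraseLead.coeff b < 0 := by
          rw [hEd', hcoeT b (by simp)]
          rw [hQa] at hab
          rcases mul_neg_iff.mp hab with ⟨h1, h2⟩ | ⟨h1, h2⟩
          · rw [sign_pos h1] at hsame
            exact mul_neg_of_pos_of_neg (sign_eq_one_iff.mp hsame.symm) h2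
          · rw [sign_neg h1] at hsame
            exact mul_neg_of_neg_of_pos (sign_eq_neg_one_iff.mp hsame.symm) h2
        have hne : b ≠ Q.eraseLead.natDegree := by
          intro hbd
          rw [← hbd] at hprod
          exact absurd hprod (not_lt.mpr (mul_self_nonneg _))
        have hblt : b < Q.eraseLead.natDegree := lt_of_le_of_ne hbd' hne
        have hsortN : (Q.eraseLead.natDegree :: b :: L').Pairwise (· > ·) := by
          refine List.pairwise_cons.mpr ⟨?_, hsortT⟩
          intro t ht
          rcases List.mem_cons.mp ht with rfl | ht'
          · exact hblt
          · exact lt_trans ((List.pairwise_cons.mp hsortT).1 t ht') hblt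
        have hnzN : ∀ t ∈ (Q.eraseLead.natDegree :: b :: L'), Q.eraseLead.coeff t ≠ 0 := by
          intro t ht
          rcases List.mem_cons.mp ht with rfl | ht'
          · rw [hEd']; exact leadingCoeff_ne_zero.mpr hE
          · exact hnzT t ht'
        have hchainN : (Q.eraseLead.natDegree :: b :: L').IsChain
            (fun x y => Q.eraseLead.coeff x * Q.eraseLead.coeff y < 0) :=
          List.IsChain.cons_cons hprod hchainT
        have h1 := ih (n - 1) hltE Q.eraseLead _ hcardE hsortN hnzN hchainN
        simp only [List.length_cons] at h1 ⊢
        omega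
    · -- `a` below the degree: erasing the lead keeps every anchor
      have hcoe : ∀ t ∈ (a :: b :: L'), Q.eraseLead.coeff t = Q.coeff t := by
        intro t ht
        apply eraseLead_coeff_of_ne
        rcases List.mem_cons.mp ht with rfl | ht'
        · exact hlt.ne
        · exact (lt_trans (htail t ht') hlt).ne
      have hchainE : (a :: b :: L').IsChain (fun x y => Q.eraseLead.coeff x * Q.eraseLead.coeff y < 0) := by
        refine List.IsChain.imp_of_mem_imp ?_ hchain
        intro x y hx hy hxy
        rwa [hcoe x hx, hcoe y hy]
      have hnzE : ∀ t ∈ (a :: b :: L'), Q.eraseLead.coeff t ≠ 0 := fun t ht => by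
        rw [hcoe t ht]; exact hnz t ht
      have h1 := ih (n - 1) hltE Q.eraseLead (a :: b :: L') hcardE hsort hnzE hchainE
      simp only [List.length_cons] at h1 ⊢
      omega

/-- Non-vanishing along a chain of negative products (length ≥ 2). -/
theorem ne_zero_of_isChain_mul_neg (f : ℕ → ℝ) :
    ∀ (a b : ℕ) (L : List ℕ), (a :: b :: L).IsChain (fun x y => f x * f y < 0) → ∀ t ∈ (a :: b :: L), f t ≠ 0
  | a, b, [], h => by
    obtain ⟨hab, _⟩ := List.isChain_cons_cons.mp h
    intro t ht
    rcases List.mem_cons.mp ht with rfl | ht'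
    · exact left_ne_zero_of_mul hab.ne
    · rw [List.mem_singleton] at ht'
      rw [ht']; exact right_ne_zero_of_mul hab.ne
  | a, b, c :: L, h => by
    obtain ⟨hab, h'⟩ := List.isChain_cons_cons.mp h
    intro t ht
    rcases List.mem_cons.mp ht with rfl | ht'
    · exact left_ne_zero_of_mul hab.ne
    · exact ne_zero_of_isChain_mul_neg f b c L h' t ht'

/-- Transfer of an alternating chain along positively proportional coefficients. -/
theorem isChain_mul_neg_transfer {P R : ℝ[X]} {M V : List ℕ}
    (hF : List.Forall₂ (fun m v => ∃ κ : ℝ, 0 < κ ∧ R.coeff m = κ * P.coeff v) M V)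
    (hV : V.IsChain (fun a b => P.coeff a * P.coeff b < 0)) :
    M.IsChain (fun a b => R.coeff a * R.coeff b < 0) := by
  induction hF with
  | nil => exact List.IsChain.nil
  | @cons m v M' V' hmv hF' ih =>
    cases hF' with
    | nil => exact List.IsChain.singleton m
    | @cons m₂ v₂ M'' V'' hmv₂ hF'' =>
      obtain ⟨κ₁, hκ₁, e₁⟩ := hmv
      obtain ⟨κ₂, hκ₂, e₂⟩ := hmv₂
      obtain ⟨h12, hV'⟩ := List.isChain_cons_cons.mp hV
      refine List.IsChain.cons_cons ?_ (ih hV')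
      rw [e₁, e₂, show κ₁ * P.coeff v * (κ₂ * P.coeff v₂) = (κ₁ * κ₂) * (P.coeff v * P.coeff v₂) by ring]
      exact mul_neg_of_pos_of_neg (mul_pos hκ₁ hκ₂) h12

/-- Transfer of non-vanishing along positively proportional coefficients. -/
theorem ne_zero_transfer {P R : ℝ[X]} {M V : List ℕ}
    (hF : List.Forall₂ (fun m v => ∃ κ : ℝ, 0 < κ ∧ R.coeff m = κ * P.coeff v) M V)
    (hV : ∀ v ∈ V, P.coeff v ≠ 0) : ∀ m ∈ M, R.coeff m ≠ 0 := by
  induction hF with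
  | nil => simp
  | @cons m v M' V' hmv _ ih =>
    intro t ht
    obtain ⟨κ, hκ, e⟩ := hmv
    rcases List.mem_cons.mp ht with rfl | ht'
    · rw [e]; exact mul_ne_zero hκ.ne' (hV v List.mem_cons_self)
    · exact ih (fun w hw => hV w (List.mem_cons_of_mem v hw)) t ht'

/-- **Poincaré factors of exponent `N ≤ 3` are useless on the 15-nomial support `V15`.**  If `P : ℝ[X]` is
supported on `{14,17,20,28,30,33,36,44,48,51,54,60,62,78,96}` with coefficients of alternating non-zero signs
along it, then `P * (X + C s)^N`, `s > 0`, `N ≤ 3`, still has at least 14 sign variations. [folklore] -/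
theorem fourteen_le_signVariations_mul_X_add_C_pow (P : ℝ[X])
    (hsupp : P.support ⊆ [14, 17, 20, 28, 30, 33, 36, 44, 48, 51, 54, 60, 62, 78, 96].toFinset)
    (halt : [96, 78, 62, 60, 54, 51, 48, 44, 36, 33, 30, 28, 20, 17, 14].IsChain
      (fun a b => P.coeff a * P.coeff b < 0))
    {s : ℝ} (hs : 0 < s) {N : ℕ} (hN : N ≤ 3) :
    14 ≤ (P * (X + C s) ^ N).signVariations := by
  have hz : ∀ k, k ∉ [14, 17, 20, 28, 30, 33, 36, 44, 48, 51, 54, 60, 62, 78, 96] → P.coeff k = 0 := by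
    intro k hk
    by_contra h
    exact hk (List.mem_toFinset.mp (hsupp (mem_support_iff.mpr h)))
  have hnzV := ne_zero_of_isChain_mul_neg P.coeff 96 78 _ halt
  have key1 : ∀ (Q : ℝ[X]) (d : ℕ), (Q * (X + C s)).coeff (d + 1) = Q.coeff d + s * Q.coeff (d + 1) := by
    intro Q d; rw [mul_add, coeff_add, coeff_mul_X, coeff_mul_C]; ring
  have key2 : ∀ (Q : ℝ[X]) (d : ℕ), (Q * (X + C s) ^ 2).coeff (d + 2) =
      Q.coeff d + 2 * s * Q.coeff (d + 1) + s ^ 2 * Q.coeff (d + 2) := by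
    intro Q d
    rw [pow_two, ← mul_assoc, key1, key1, key1]; ring
  have key3 : ∀ (Q : ℝ[X]) (d : ℕ), (Q * (X + C s) ^ 3).coeff (d + 3) =
      Q.coeff d + 3 * s * Q.coeff (d + 1) + 3 * s ^ 2 * Q.coeff (d + 2) + s ^ 3 * Q.coeff (d + 3) := by
    intro Q d
    rw [pow_succ, ← mul_assoc, key1, key2, key2]; ring
  interval_cases N
  · -- N = 0: the 15-nomial itself
    rw [pow_zero, mul_one]
    have h := length_le_signVariations_succ_of_alternating _ P _ rfl (by decide) hnzV halt
    simp only [List.length_cons, List.length_nil] at h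
    omega
  · -- N = 1: every `v ∈ V15` is pure (`v - 1 ∉ V15`)
    have hF : List.Forall₂ (fun m v => ∃ κ : ℝ, 0 < κ ∧ (P * (X + C s) ^ 1).coeff m = κ * P.coeff v)
        [95+1, 77+1, 61+1, 59+1, 53+1, 50+1, 47+1, 43+1, 35+1, 32+1, 29+1, 27+1, 19+1, 16+1, 13+1]
        [96, 78, 62, 60, 54, 51, 48, 44, 36, 33, 30, 28, 20, 17, 14] := by
      refine .cons ⟨s, hs, ?_⟩ (.cons ⟨s, hs, ?_⟩ (.cons ⟨s, hs, ?_⟩ (.cons ⟨s, hs, ?_⟩ (.cons ⟨s, hs, ?_⟩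
        (.cons ⟨s, hs, ?_⟩ (.cons ⟨s, hs, ?_⟩ (.cons ⟨s, hs, ?_⟩ (.cons ⟨s, hs, ?_⟩ (.cons ⟨s, hs, ?_⟩
        (.cons ⟨s, hs, ?_⟩ (.cons ⟨s, hs, ?_⟩ (.cons ⟨s, hs, ?_⟩ (.cons ⟨s, hs, ?_⟩ (.cons ⟨s, hs, ?_⟩
        .nil))))))))))))))
      all_goals (rw [pow_one, key1]; simp [hz])
    have h := length_le_signVariations_succ_of_alternating _ _ _ rfl (by decide) (ne_zero_transfer hF hnzV)
      (isChain_mul_neg_transfer hF halt)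
    simp only [List.length_cons, List.length_nil] at h
    omega
  · -- N = 2: pure positions `v` except `31` for `v = 30` and `63` for `v = 62`
    have hF : List.Forall₂ (fun m v => ∃ κ : ℝ, 0 < κ ∧ (P * (X + C s) ^ 2).coeff m = κ * P.coeff v)
        [94+2, 76+2, 61+2, 58+2, 52+2, 49+2, 46+2, 42+2, 34+2, 31+2, 29+2, 26+2, 18+2, 15+2, 12+2]
        [96, 78, 62, 60, 54, 51, 48, 44, 36, 33, 30, 28, 20, 17, 14] := by
      refine .cons ⟨s ^ 2, by positivity, ?_⟩ (.cons ⟨s ^ 2, by positivity, ?_⟩ (.cons ⟨2 * s, by positivity, ?_⟩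
        (.cons ⟨s ^ 2, by positivity, ?_⟩ (.cons ⟨s ^ 2, by positivity, ?_⟩ (.cons ⟨s ^ 2, by positivity, ?_⟩
        (.cons ⟨s ^ 2, by positivity, ?_⟩ (.cons ⟨s ^ 2, by positivity, ?_⟩ (.cons ⟨s ^ 2, by positivity, ?_⟩
        (.cons ⟨s ^ 2, by positivity, ?_⟩ (.cons ⟨2 * s, by positivity, ?_⟩ (.cons ⟨s ^ 2, by positivity, ?_⟩
        (.cons ⟨s ^ 2, by positivity, ?_⟩ (.cons ⟨s ^ 2, by positivity, ?_⟩ (.cons ⟨s ^ 2, by positivity, ?_⟩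
        .nil))))))))))))))
      all_goals (rw [key2]; simp [hz])
    have h := length_le_signVariations_succ_of_alternating _ _ _ rfl (by decide) (ne_zero_transfer hF hnzV)
      (isChain_mul_neg_transfer hF halt)
    simp only [List.length_cons, List.length_nil] at h
    omega
  · -- N = 3: pure positions `14,18,21,28,32,34,37,44,48,52,55,60,64,78,96`
    have hF : List.Forall₂ (fun m v => ∃ κ : ℝ, 0 < κ ∧ (P * (X + C s) ^ 3).coeff m = κ * P.coeff v)
        [93+3, 75+3, 61+3, 57+3, 52+3, 49+3, 45+3, 41+3, 34+3, 31+3, 29+3, 25+3, 18+3, 15+3, 11+3]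
        [96, 78, 62, 60, 54, 51, 48, 44, 36, 33, 30, 28, 20, 17, 14] := by
      refine .cons ⟨s ^ 3, by positivity, ?_⟩ (.cons ⟨s ^ 3, by positivity, ?_⟩ (.cons ⟨3 * s, by positivity, ?_⟩
        (.cons ⟨s ^ 3, by positivity, ?_⟩ (.cons ⟨3 * s ^ 2, by positivity, ?_⟩
        (.cons ⟨3 * s ^ 2, by positivity, ?_⟩ (.cons ⟨s ^ 3, by positivity, ?_⟩ (.cons ⟨s ^ 3, by positivity, ?_⟩
        (.cons ⟨3 * s ^ 2, by positivity, ?_⟩ (.cons ⟨3 * s ^ 2, by positivity, ?_⟩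
        (.cons ⟨3 * s, by positivity, ?_⟩ (.cons ⟨s ^ 3, by positivity, ?_⟩ (.cons ⟨3 * s ^ 2, by positivity, ?_⟩
        (.cons ⟨3 * s ^ 2, by positivity, ?_⟩ (.cons ⟨s ^ 3, by positivity, ?_⟩
        .nil))))))))))))))
      all_goals (rw [key3]; simp [hz])
    have h := length_le_signVariations_succ_of_alternating _ _ _ rfl (by decide) (ne_zero_transfer hF hnzV)
      (isChain_mul_neg_transfer hF halt)
    simp only [List.length_cons, List.length_nil] at h
    omega

end Summit.ValiantsHypothesis.ValiantsHypothesis.Theorems.DoorA26.Negative
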